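import Summits.BirchSwinnertonDyer.BirchSwinnertonDyer.Theorems.UniversalToricDescentThinCombResidualInvisibility
import Summits.BirchSwinnertonDyer.BirchSwinnertonDyer.Theorems.UniversalToricDescentThinCombTransport
import HarnessLib

/-!
# THE BLIND SPOT OF THE RATIONAL THIN COMB, EXACTLY: `ThinCombDvdRat 𝒪 p Q 1 ↔ Q = p^μ·(T₂^s·v + p·R)` (`v` a unit)
# (crux `RationalSplitIMCInclusionAtThree`, stmt-BirchSwinnertonDyer-24207, line `ratwall_thin_comb`; helper,
# `--supports stmt-BirchSwinnertonDyer-24207`; cell `pub/bsd-wall`, LEAD `cruxlead-24207` g25)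

WHY THIS FILE. `…ThinComb.VerticalInvisibility` (p763523) and `…ThinComb.ResidualInvisibility` (p763714) show that the
rational comb of the research stub `stub_ratCombDvdUpTo2` (`ThinCombDvdRat R₀ 3 g L₂`) cannot see any factor of `g` of
the form `p^μ·(T₂^s·v + p·R)` (`v` a unit, `R` arbitrary: «residually vertical up to `p`-content»). This file proves
the CONVERSE over any DVR `𝒪` with maximal ideal `(p)`, so that the blind spot is known EXACTLY:

* §1 `isUnit_of_isUnit_map_mk`: units lift along the level reduction `Λ₂(𝒪) → 𝒪_m⟦T₁⟧` (`𝒪` local, `p` a non-unit: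
  `a·b = 1 + c·E_m` gives `a(0)b(0) = 1 + c(0)·p`, a unit); `isUnit_add_T₂_mul`.
* §2 ONE-LEVEL DICHOTOMY `residuallyVertical_or_mem_of_const_pow_mem`: if `p^N ∈ (Q, E_m(T₂))` then EITHER
  `Q = T₂^s·v + p·R` with `s < deg E_m`, `v` a unit (RESIDUALLY VERTICAL), OR `Q ∈ (p, E_m(T₂))`. Proof: the tree's shape
  lemma `…ThinCombVisibility.shape_of_const_pow_mem` gives `Q ≡ ϖ^s·u (mod E_m)`, `u` a unit of `𝒪_m⟦T₁⟧`; if `s < d`,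
  `…ThinCombTransport.mem_span_combElt_iff_map_dvd` gives `Q = A·T₂^s + B·E_m` with `A ≡ u`, so `A` is a unit (§1) and
  `Q = T₂^s(A + T₂^{d−s}B) + p·(w B)` (`E_m = T₂^d + p·w`); if `s ≥ d`, `ϖ^s = p·(unit)·ϖ^{s−d}` so `p ∣ Q (mod E_m)`.
* §3 UNBOUNDED LEVELS `const_dvd_or_residuallyVertical`: if `p^{N_m} ∈ (Q, E_m)` on levels of unbounded order then
  `p ∣ Q` or `Q` is residually vertical (the second alternative of §2 on levels with `deg E_m → ∞` forces every
  coefficient of `Q` into `(p)`, because `E_m ≡ X^{deg E_m} (mod p)`).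
* §4 THE CHARACTERISATION `thinCombDvdRat_one_iff`: for `Q ≠ 0`,
  `ThinCombDvdRat 𝒪 p Q 1 ↔ ∃ μ s v R, IsUnit v ∧ Q = p^μ·(T₂^s·v + p·R)` (`→`: `p`-content by
  `WfDvdMonoid.max_power_factor`, then §3; `←`: ResidualInvisibility + VerticalInvisibility.const_mul); and
  `blind_iff_thinCombDvdRat_one`: `Q` is COMB-INVISIBLE (`∀ G F, ThinCombDvdRat G F → ThinCombDvdRat (Q·G) F`) iff
  `ThinCombDvdRat 𝒪 p Q 1`. §5: the crux's ring `Λ₂(unrIntegers 3)`, `p = 3`.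

READING FOR THE STUB. The registered `stub_ratCombDvdUpTo2` determines the generator `g` of `Ch_{Λ₂}(X₂)` exactly up to
the factors `3^μ·(T₂^s·v + 3·R)`: the `μ`-invariant, the vertical (`𝔭′`-line) divisors, and every prime of `Λ₂(R₀)`
that is CONGRUENT MODULO `3` to a vertical monomial times a unit (e.g. `T₂ + 3T₁`). Everything in this class must come
from the two functional equations of the line (`stub_toricExistsSymmUpTo2` (ii), `stub_charIdealInvSymmUpTo2`) through
`dvd_pow_mul_of_weakReflection`; nothing else can. (LEAD-CENSUS-g16 §1.3, corrected in g25.)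

HONEST FRAMING. Commutative algebra about the SHAPE of one registered stub; nothing here is evidence for or against the
stub; BSD is not proved for any curve by any of this.

References: [cite: Washington1997, Lemma 1.4, §7.1–§7.2, §13.2 (structure of `Λ`-modules, `μ`-invariant)].
-/

set_option linter.dupNamespace false
set_option autoImplicit false

noncomputable section

namespace Summit.BirchSwinnertonDyer.BirchSwinnertonDyer.Theorems.UniversalToricDescentThinComb.BlindSpot

open Polynomial
open Literature.NumberTheory.EllipticCurves
open Summit.BirchSwinnertonDyer.BirchSwinnertonDyer.Theorems.UniversalToricDescentThinComb

/-! ## §1 Units lift along the level reduction `Λ₂(𝒪) → 𝒪_m⟦T₁⟧` -/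

section Lift

variable (𝒪 : Type*) [CommRing 𝒪] (p m : ℕ) [hp : Fact p.Prime]

omit hp in
/-- `A + T₂·y` is a unit of `Λ₂(𝒪)` whenever `A` is. [cite: Washington1997, §7.1] -/
theorem isUnit_add_T₂_mul {A : PowerSeries (PowerSeries 𝒪)} (hA : IsUnit A) (y : PowerSeries (PowerSeries 𝒪)) :
    IsUnit (A + T₂ 𝒪 * y) := by
  obtain ⟨a, rfl⟩ := hA
  have : (↑a : PowerSeries (PowerSeries 𝒪)) + T₂ 𝒪 * y =
      ↑a * (1 + T₂ 𝒪 * (((a⁻¹ : (PowerSeries (PowerSeries 𝒪))ˣ) : PowerSeries (PowerSeries 𝒪)) * y)) := by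
    rw [mul_add, mul_one, ← mul_assoc, ← mul_assoc, mul_comm (↑a : PowerSeries (PowerSeries 𝒪)) (T₂ 𝒪),
      mul_assoc (T₂ 𝒪), Units.mul_inv, mul_one]
  rw [this]
  exact (Units.isUnit a).mul (ResidualInvisibility.isUnit_one_add_T₂_mul 𝒪 _)

/-- **Units lift along `Λ₂(𝒪) → 𝒪_m⟦T₁⟧`** (`𝒪` local, `p` a non-unit): if the reduction of `A` modulo `E_m(T₂)` is a
unit then `A` is a unit — from `a·b = 1 + c·E_m` in `𝒪⟦X⟧` read `a(0)·b(0) = 1 + c(0)·p`, a unit of the local ring `𝒪`.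
[cite: Washington1997, §7.1] -/
theorem isUnit_of_isUnit_map_mk [IsLocalRing 𝒪] (hpu : ¬ IsUnit (p : 𝒪)) {A : PowerSeries (PowerSeries 𝒪)}
    (hA : IsUnit (PowerSeries.map (Ideal.Quotient.mk (Ideal.span {combSeries 𝒪 p m})) A)) : IsUnit A := by
  set π := Ideal.Quotient.mk (Ideal.span {combSeries 𝒪 p m}) with hπ
  -- the constant term `a = A(0) ∈ 𝒪⟦X⟧` reduces to a unit of `𝒪_m`
  have ha : IsUnit (π (PowerSeries.constantCoeff A)) := by
    have := PowerSeries.isUnit_constantCoeff _ hA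
    rwa [← PowerSeries.coeff_zero_eq_constantCoeff_apply, PowerSeries.coeff_map,
      PowerSeries.coeff_zero_eq_constantCoeff_apply] at this
  obtain ⟨bbar, hb⟩ := ha.exists_right_inv
  obtain ⟨b, rfl⟩ := Ideal.Quotient.mk_surjective bbar
  rw [← map_mul, ← map_one π, Ideal.Quotient.eq, Ideal.mem_span_singleton'] at hb
  obtain ⟨c, hc⟩ := hb
  -- `a(0) b(0) - 1 = c(0) · p`
  have h0 := congrArg PowerSeries.constantCoeff hc
  rw [map_mul, map_sub, map_mul, map_one, constantCoeff_combSeries] at h0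
  have hunit : IsUnit (PowerSeries.constantCoeff (PowerSeries.constantCoeff A) * PowerSeries.constantCoeff b) := by
    have h1 : PowerSeries.constantCoeff (PowerSeries.constantCoeff A) * PowerSeries.constantCoeff b =
        1 - (-(PowerSeries.constantCoeff c * (p : 𝒪))) := by rw [sub_neg_eq_add, h0]; ring
    rw [h1]
    refine IsLocalRing.isUnit_one_sub_self_of_mem_nonunits _ ?_
    rw [← IsLocalRing.mem_maximalIdeal, neg_mem_iff]
    exact Ideal.mul_mem_left _ _ ((IsLocalRing.mem_maximalIdeal _).mpr hpu)
  exact PowerSeries.isUnit_iff_constantCoeff.mpr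
    (PowerSeries.isUnit_iff_constantCoeff.mpr (isUnit_of_mul_isUnit_left hunit))

end Lift

/-! ## §2 One-level dichotomy: invisible at level `m` ⇒ residually vertical, or in `(p, E_m)` -/

section Dichotomy

variable (𝒪 : Type*) [CommRing 𝒪] [IsDomain 𝒪] [IsDiscreteValuationRing 𝒪] (p : ℕ) [hp : Fact p.Prime] (m : ℕ)

/-- **ONE-LEVEL DICHOTOMY.** If `p^N ∈ (Q, E_m(T₂))` in `Λ₂(𝒪)` (`𝒪` a DVR with maximal ideal `(p)`), then either
`Q = T₂^s·v + p·R` with `s < deg E_m` and `v` a unit (RESIDUALLY VERTICAL), or `Q ∈ (p, E_m(T₂))`.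
[cite: Washington1997, Lemma 1.4 and §7.1–§7.2] -/
theorem residuallyVertical_or_mem_of_const_pow_mem (hmax : IsLocalRing.maximalIdeal 𝒪 = Ideal.span {(p : 𝒪)})
    {Q : PowerSeries (PowerSeries 𝒪)} {N : ℕ} (h : const 𝒪 ((p : 𝒪) ^ N) ∈ Ideal.span {Q, combElt 𝒪 p m}) :
    (∃ s : ℕ, s < (combPoly p m).natDegree ∧ ∃ v R : PowerSeries (PowerSeries 𝒪), IsUnit v ∧
        Q = T₂ 𝒪 ^ s * v + const 𝒪 (p : 𝒪) * R) ∨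
      Q ∈ Ideal.span {const 𝒪 (p : 𝒪), combElt 𝒪 p m} := by
  obtain ⟨hp0, hpu, -, -⟩ := p_ne_zero_of_maximalIdeal_eq 𝒪 p hmax
  obtain ⟨s, u, hu, hshape⟩ := shape_of_const_pow_mem 𝒪 p m hmax h
  set π := Ideal.Quotient.mk (Ideal.span {combSeries 𝒪 p m}) with hπ
  set d := (combPoly p m).natDegree with hd
  have hE : PowerSeries.map π (combElt 𝒪 p m) = 0 := by
    rw [combElt, PowerSeries.map_C, Ideal.Quotient.eq_zero_iff_mem.mpr (Ideal.mem_span_singleton_self _), map_zero]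
  have hT : ∀ k : ℕ, PowerSeries.map π (T₂ 𝒪 ^ k) = PowerSeries.C ((π PowerSeries.X) ^ k) := by
    intro k; rw [map_pow, T₂, PowerSeries.map_C, map_pow]
  obtain ⟨w, -, hw⟩ := combSeries_eq_X_pow_add 𝒪 p m
  have hEm : combElt 𝒪 p m = T₂ 𝒪 ^ d + const 𝒪 (p : 𝒪) * PowerSeries.C w := by
    rw [combElt, hw, map_add, map_pow, map_mul]; rfl
  by_cases hs : s < d
  · left
    -- `Q = A·T₂^s + B·E_m` with `A ≡ u` a unit
    have hmem : Q ∈ Ideal.span {T₂ 𝒪 ^ s, combElt 𝒪 p m} :=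
      (mem_span_combElt_iff_map_dvd 𝒪 p m (T₂ 𝒪 ^ s) Q).mpr ⟨u, by rw [hshape, hT]⟩
    obtain ⟨A, B, hAB⟩ := Ideal.mem_span_pair.mp hmem
    have hA : PowerSeries.map π A = u := by
      have h1 := congrArg (PowerSeries.map π) hAB
      rw [map_add, map_mul, map_mul, hE, mul_zero, add_zero, hshape, hT, mul_comm] at h1
      have h2 : PowerSeries.C ((π PowerSeries.X) ^ s) * (PowerSeries.map π A - u) = 0 := by
        rw [mul_sub, h1, sub_self]
      exact sub_eq_zero.mp (C_mul_eq_zero_imp (fun z hz ↦ varpi_pow_mul_eq_zero_imp 𝒪 p m hp0 s hz) h2)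
    have hAu : IsUnit A := isUnit_of_isUnit_map_mk 𝒪 p m hpu (hA ▸ hu)
    obtain ⟨e, he⟩ := Nat.exists_eq_add_of_lt hs
    refine ⟨s, hs, A + T₂ 𝒪 * (T₂ 𝒪 ^ e * B), PowerSeries.C w * B, isUnit_add_T₂_mul 𝒪 hAu _, ?_⟩
    rw [← hAB, hEm, he]
    ring
  · right
    -- `s ≥ d`: `ϖ^s = p · (unit) · ϖ^(s-d)`, so `p ∣ Q (mod E_m)`
    obtain ⟨e, he⟩ := Nat.exists_eq_add_of_le (not_lt.mp hs)
    obtain ⟨w₀, hw₀⟩ := exists_natCast_p_eq_varpi_pow_mul 𝒪 p m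
    refine (mem_span_combElt_iff_map_dvd 𝒪 p m (const 𝒪 (p : 𝒪)) Q).mpr
      ⟨PowerSeries.C (((w₀⁻¹ : (LevelRing 𝒪 p m)ˣ) : LevelRing 𝒪 p m) * (π PowerSeries.X) ^ e) * u, ?_⟩
    have hπp : PowerSeries.map π (const 𝒪 (p : 𝒪)) = PowerSeries.C (p : LevelRing 𝒪 p m) := by
      rw [const, RingHom.comp_apply, PowerSeries.map_C, map_natCast, map_natCast]
    rw [hshape, hπp, ← mul_assoc, ← map_mul, he, pow_add, hw₀]
    congr 2
    rw [mul_assoc, ← mul_assoc (↑w₀ : LevelRing 𝒪 p m), Units.mul_inv, one_mul]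

/-! ## §3 Unbounded levels: `p ∣ Q`, or `Q` is residually vertical -/

/-- **Invisible on levels of unbounded order ⇒ `p ∣ Q` or `Q` residually vertical.** If for every `n` there is a level
`m ≥ n` with `p^{N} ∈ (Q, E_m(T₂))`, then `p ∣ Q` in `Λ₂(𝒪)` or `Q = T₂^s·v + p·R` with `v` a unit. (If the first
alternative of the dichotomy never occurs, `Q ∈ (p, E_m)` with `E_m ≡ X^{deg E_m} (mod p)` and `deg E_m → ∞` puts every
coefficient of `Q` in `(p)`.) [cite: Washington1997, §7.1–§7.2] -/
theorem const_dvd_or_residuallyVertical (hmax : IsLocalRing.maximalIdeal 𝒪 = Ideal.span {(p : 𝒪)})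
    {Q : PowerSeries (PowerSeries 𝒪)}
    (h : ∀ n : ℕ, ∃ m : ℕ, n ≤ m ∧ ∃ N : ℕ, const 𝒪 ((p : 𝒪) ^ N) ∈ Ideal.span {Q, combElt 𝒪 p m}) :
    const 𝒪 (p : 𝒪) ∣ Q ∨
      ∃ (s : ℕ) (v R : PowerSeries (PowerSeries 𝒪)), IsUnit v ∧ Q = T₂ 𝒪 ^ s * v + const 𝒪 (p : 𝒪) * R := by
  classical
  by_cases hres : ∃ (s : ℕ) (v R : PowerSeries (PowerSeries 𝒪)), IsUnit v ∧
      Q = T₂ 𝒪 ^ s * v + const 𝒪 (p : 𝒪) * R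
  · exact Or.inr hres
  left
  -- every coefficient of `Q` is divisible by `p`
  have hcoef : ∀ i j : ℕ, (p : 𝒪) ∣ PowerSeries.coeff j (PowerSeries.coeff i Q) := by
    intro i j
    obtain ⟨m, hjm, N, hN⟩ := h j
    have hjd : j < (combPoly p m).natDegree := lt_of_le_of_lt hjm (lt_natDegree_combPoly p m)
    rcases residuallyVertical_or_mem_of_const_pow_mem 𝒪 p m hmax hN with ⟨s, -, v, R, hv, hQ⟩ | hmem
    · exact absurd ⟨s, v, R, hv, hQ⟩ hres
    obtain ⟨a, b, hab⟩ := Ideal.mem_span_pair.mp hmem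
    have hi : PowerSeries.coeff i Q =
        PowerSeries.C (p : 𝒪) * PowerSeries.coeff i a + combSeries 𝒪 p m * PowerSeries.coeff i b := by
      rw [← hab, map_add, const, RingHom.comp_apply, PowerSeries.coeff_mul_C, combElt, PowerSeries.coeff_mul_C]
      ring
    rw [hi, map_add, PowerSeries.coeff_C_mul, PowerSeries.coeff_mul]
    refine dvd_add (dvd_mul_right _ _) (Finset.dvd_sum fun k hk ↦ dvd_mul_of_dvd_left ?_ _)
    have hk1 : k.1 ≤ j := Finset.HasAntidiagonal.antidiagonal.fst_le hk
    exact p_dvd_coeff_combSeries 𝒪 p m (lt_of_le_of_lt hk1 hjd)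
  choose c hc using hcoef
  refine ⟨PowerSeries.mk fun i ↦ PowerSeries.mk fun j ↦ c i j, ?_⟩
  ext i j
  rw [show const 𝒪 (p : 𝒪) = PowerSeries.C (PowerSeries.C (p : 𝒪)) from rfl, PowerSeries.coeff_C_mul,
    PowerSeries.coeff_mk, PowerSeries.coeff_C_mul, PowerSeries.coeff_mk, hc]

/-! ## §4 The characterisation of the blind spot -/

/-- **THE BLIND SPOT, EXACTLY.** For `Q ≠ 0` in `Λ₂(𝒪)` (`𝒪` a DVR with maximal ideal `(p)`):
`ThinCombDvdRat 𝒪 p Q 1` — the rational comb certifies nothing about `Q` — iff `Q = p^μ·(T₂^s·v + p·R)` with `v` a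
unit, i.e. iff the `p`-primitive part of `Q` is CONGRUENT MODULO `p` to a vertical monomial times a unit.
(`→`: `p`-content by `WfDvdMonoid.max_power_factor`, then §3 for the primitive part; `←`: ResidualInvisibility and
VerticalInvisibility.) [cite: Washington1997, §7.1–§7.2 and §13.2] -/
theorem thinCombDvdRat_one_iff (hmax : IsLocalRing.maximalIdeal 𝒪 = Ideal.span {(p : 𝒪)})
    {Q : PowerSeries (PowerSeries 𝒪)} (hQ : Q ≠ 0) :
    ThinCombDvdRat 𝒪 p Q 1 ↔ ∃ (μ s : ℕ) (v R : PowerSeries (PowerSeries 𝒪)), IsUnit v ∧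
      Q = const 𝒪 ((p : 𝒪) ^ μ) * (T₂ 𝒪 ^ s * v + const 𝒪 (p : 𝒪) * R) := by
  obtain ⟨hp0, hpu, -, hpprime⟩ := p_ne_zero_of_maximalIdeal_eq 𝒪 p hmax
  constructor
  · intro hcomb
    have hCirr : Irreducible (const 𝒪 (p : 𝒪)) :=
      (prime_C_of_prime (prime_C_of_prime hpprime)).irreducible
    obtain ⟨μ, Q₀, hndvd, rfl⟩ := WfDvdMonoid.max_power_factor hQ hCirr
    -- the comb hypothesis descends to the `p`-primitive part `Q₀`
    have h₀ : ∀ n : ℕ, ∃ m : ℕ, n ≤ m ∧ ∃ N : ℕ, const 𝒪 ((p : 𝒪) ^ N) ∈ Ideal.span {Q₀, combElt 𝒪 p m} := by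
      intro n
      obtain ⟨m, hnm, t, ht⟩ := hcomb n
      refine ⟨m, hnm, t, ?_⟩
      rw [mul_one] at ht
      obtain ⟨a, b, hab⟩ := Ideal.mem_span_pair.mp ht
      exact Ideal.mem_span_pair.mpr ⟨a * const 𝒪 (p : 𝒪) ^ μ, b, by rw [← hab]; ring⟩
    rcases const_dvd_or_residuallyVertical 𝒪 p hmax h₀ with hdvd | ⟨s, v, R, hv, hQ₀⟩
    · exact absurd hdvd hndvd
    · exact ⟨μ, s, v, R, hv, by rw [hQ₀, map_pow]⟩
  · rintro ⟨μ, s, v, R, hv, rfl⟩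
    have hX : (PowerSeries.X : PowerSeries 𝒪) ^ s = PowerSeries.X ^ s + PowerSeries.C (p : 𝒪) * 0 := by
      rw [mul_zero, add_zero]
    have hQ₁ : T₂ 𝒪 ^ s * v + const 𝒪 (p : 𝒪) * R = PowerSeries.C (PowerSeries.X ^ s) * v + const 𝒪 (p : 𝒪) * R := by
      rw [T₂, map_pow]
    simpa only [mul_one] using
      VerticalInvisibility.ThinCombDvdRat.const_mul 𝒪 p (dvd_refl ((p : 𝒪) ^ μ))
        (ResidualInvisibility.ThinCombDvdRat.mul_of_residuallyVertical 𝒪 p hX hv hQ₁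
          (RatCombTightness.thinCombDvdRat_of_dvd 𝒪 p (dvd_refl (1 : PowerSeries (PowerSeries 𝒪)))))

/-- **COMB-INVISIBILITY is `ThinCombDvdRat Q 1`**: `Q ≠ 0` satisfies `ThinCombDvdRat 𝒪 p G F → ThinCombDvdRat 𝒪 p (Q·G) F`
for all `G, F` iff `ThinCombDvdRat 𝒪 p Q 1` (iff `Q = p^μ·(T₂^s·v + p·R)`, `thinCombDvdRat_one_iff`).
[cite: Washington1997, §7.1–§7.2] -/
theorem blind_iff_thinCombDvdRat_one (hmax : IsLocalRing.maximalIdeal 𝒪 = Ideal.span {(p : 𝒪)})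
    {Q : PowerSeries (PowerSeries 𝒪)} (hQ : Q ≠ 0) :
    (∀ G F : PowerSeries (PowerSeries 𝒪), ThinCombDvdRat 𝒪 p G F → ThinCombDvdRat 𝒪 p (Q * G) F) ↔
      ThinCombDvdRat 𝒪 p Q 1 := by
  constructor
  · intro h
    simpa only [mul_one] using h 1 1 (RatCombTightness.thinCombDvdRat_of_dvd 𝒪 p (dvd_refl _))
  · intro h G F hGF
    obtain ⟨μ, s, v, R, hv, rfl⟩ := (thinCombDvdRat_one_iff 𝒪 p hmax hQ).mp h
    have hX : (PowerSeries.X : PowerSeries 𝒪) ^ s = PowerSeries.X ^ s + PowerSeries.C (p : 𝒪) * 0 := by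
      rw [mul_zero, add_zero]
    have hQ₁ : T₂ 𝒪 ^ s * v + const 𝒪 (p : 𝒪) * R = PowerSeries.C (PowerSeries.X ^ s) * v + const 𝒪 (p : 𝒪) * R := by
      rw [T₂, map_pow]
    rw [mul_assoc]
    exact VerticalInvisibility.ThinCombDvdRat.const_mul 𝒪 p (dvd_refl ((p : 𝒪) ^ μ))
      (ResidualInvisibility.ThinCombDvdRat.mul_of_residuallyVertical 𝒪 p hX hv hQ₁ hGF)

end Dichotomy

/-! ## §5 The crux's ring `Λ₂(R₀)`, `R₀ = unrIntegers 3`, `p = 3` -/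

section Unr

open Summit.BirchSwinnertonDyer.Rank1Residual.X2.HidaLimitAlgebra

/-- **The blind spot of the rational `3`-comb of `stub_ratCombDvdUpTo2`, exactly**: for `Q ≠ 0` in `R₀⟦T₂⟧⟦T₁⟧`,
`ThinCombDvdRat R₀ 3 Q 1 ↔ Q = 3^μ·(T₂^s·v + 3·R)` with `v` a unit. [cite: Washington1997, §7.1–§7.2 and §13.2] -/
theorem thinCombDvdRat_one_iff_unr {Q : PowerSeries (PowerSeries (unrIntegers 3))} (hQ : Q ≠ 0) :
    ThinCombDvdRat (unrIntegers 3) 3 Q 1 ↔ ∃ (μ s : ℕ) (v R : PowerSeries (PowerSeries (unrIntegers 3))), IsUnit v ∧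
      Q = const (unrIntegers 3) ((((3 : ℕ) : ℕ) : unrIntegers 3) ^ μ) *
        (T₂ (unrIntegers 3) ^ s * v + const (unrIntegers 3) (((3 : ℕ) : ℕ) : unrIntegers 3) * R) := by
  haveI : Fact (Nat.Prime 3) := ⟨Nat.prime_three⟩
  haveI := isDiscreteValuationRing_unrIntegers (p := 3)
  have hmax : IsLocalRing.maximalIdeal (unrIntegers 3) = Ideal.span {((3 : ℕ) : unrIntegers 3)} :=
    (IsDiscreteValuationRing.irreducible_iff_uniformizer _).mp irreducible_natCast_p
  exact thinCombDvdRat_one_iff (unrIntegers 3) 3 hmax hQ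

/-- **Comb-invisibility in the crux's ring**: `Q ≠ 0` is invisible to the rational `3`-comb iff `ThinCombDvdRat R₀ 3 Q 1`.
[cite: Washington1997, §7.1–§7.2] -/
theorem blind_iff_thinCombDvdRat_one_unr {Q : PowerSeries (PowerSeries (unrIntegers 3))} (hQ : Q ≠ 0) :
    (∀ G F : PowerSeries (PowerSeries (unrIntegers 3)),
        ThinCombDvdRat (unrIntegers 3) 3 G F → ThinCombDvdRat (unrIntegers 3) 3 (Q * G) F) ↔
      ThinCombDvdRat (unrIntegers 3) 3 Q 1 := by
  haveI : Fact (Nat.Prime 3) := ⟨Nat.prime_three⟩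
  haveI := isDiscreteValuationRing_unrIntegers (p := 3)
  have hmax : IsLocalRing.maximalIdeal (unrIntegers 3) = Ideal.span {((3 : ℕ) : unrIntegers 3)} :=
    (IsDiscreteValuationRing.irreducible_iff_uniformizer _).mp irreducible_natCast_p
  exact blind_iff_thinCombDvdRat_one (unrIntegers 3) 3 hmax hQ

end Unr

end Summit.BirchSwinnertonDyer.BirchSwinnertonDyer.Theorems.UniversalToricDescentThinComb.BlindSpot

end
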